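import Literature.Analysis.Hypoelliptic.ShadowField
import HarnessLib

/-!
# The key identity: the Fourier side of `P (ζ u)` in terms of `(P u) ζ` and of `ζ' u`

Analysis/Hypoelliptic support file serving the discharge of
`Literature.Analysis.Distribution.Hormander1967_thm11` (the localisation step of Kohn's
bootstrap, Taylor 1981, Ch. XV §1, Lemma 1.6 / (1.19)–(1.20), in the form needed on the Fourier
side).

Let `G = G_ζ` and `G' = G_{ζ'}` be Fourier-side functions of `ζ u` and `ζ' u` (`ζ' = 1` on
`tsupport ζ`), and `Pf` the flat Hörmander operator with `x`-side link `xl` (so that `Pf G`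
represents `PfC`, `ShadowField.lean`).

* **The commutator identity** (`cutoff_PfC`): `ζ · PfC h = PfC (ζ h) - 2 ∑_j D_j (η_j h) + m h`
  with `η_j = X^j ζ`, `m = ∑_j X^j (X^j ζ) - X⁰ ζ` (`X^j ρ = ∑_k a^j_k ∂_{v_k} ρ`).
* **The key identity** (`keyIdentity`): if `uC u ζ' (PfC (ζ g)) = ∫ F ζ g dμ` for smooth `g`
  (the hypothesis "`P u = F` near `tsupport ζ`", in transposed form), then
  `Pf G =ᵐ c_T 𝓕⁻¹q - 2 ∑_j conv_{η_j} (Xf_j G') + conv_m G'`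
  where `q` is the Schwartz avatar of `F ζ` and `conv_a` the convolution coefficient of `a`;
  in particular (`inH_Pf_of_cutoff`) `Pf G ∈ Ĥ^t` as soon as `G', Xf_j G' ∈ Ĥ^t`.

## References

* M. E. Taylor, *Pseudodifferential Operators* (1981), Ch. XV §1, Lemma 1.6.
-/

noncomputable section

open MeasureTheory Set Filter Function SchwartzMap TopologicalSpace Distributions TestFunction
open scoped ENNReal NNReal Topology ComplexConjugate InnerProductSpace FourierTransform BigOperators
  ContDiff

namespace Literature.Analysis.Hypoelliptic

variable {E : Type*} [NormedAddCommGroup E] [NormedSpace ℝ E] {Ω : Opens E}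

/-! ### Vector fields applied to real functions; the Leibniz rule for `fieldC` -/

/-- `X ρ = ∑_k xa_k ∂_{v_k} ρ` for a real function `ρ`. [folklore] -/
def applyVF {ι : Type*} [Fintype ι] (xa : ι → E → ℝ) (v : ι → E) (ρ : E → ℝ) : E → ℝ :=
  fun x => ∑ k, xa k x * fderiv ℝ ρ x (v k)

/-- `X ρ` is smooth. [folklore] -/
theorem contDiff_applyVF {ι : Type*} [Fintype ι] {xa : ι → E → ℝ} (hxa : ∀ k, ContDiff ℝ ∞ (xa k))
    (v : ι → E) {ρ : E → ℝ} (hρ : ContDiff ℝ ∞ ρ) : ContDiff ℝ ∞ (applyVF xa v ρ) := by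
  unfold applyVF
  refine ContDiff.sum fun k _ => (hxa k).mul ?_
  exact (hρ.fderiv_right (m := ∞) (mod_cast le_top)).clm_apply contDiff_const

/-- `X ρ` is supported in `tsupport ρ`. [folklore] -/
theorem applyVF_eq_zero {ι : Type*} [Fintype ι] (xa : ι → E → ℝ) (v : ι → E) {ρ : E → ℝ} {x : E}
    (hx : x ∉ tsupport ρ) : applyVF xa v ρ x = 0 := by
  unfold applyVF
  simp [fderiv_of_notMem_tsupport ℝ hx]

/-- `X ρ` has compact support if `ρ` has. [folklore] -/
theorem hasCompactSupport_applyVF {ι : Type*} [Fintype ι] (xa : ι → E → ℝ) (v : ι → E) {ρ : E → ℝ}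
    (hρ : HasCompactSupport ρ) : HasCompactSupport (applyVF xa v ρ) :=
  hρ.mono' fun x hx => by
    by_contra h
    exact hx (applyVF_eq_zero xa v h)

/-- `fieldC` is additive on smooth functions. [folklore] -/
theorem fieldC_add {ι : Type*} [Fintype ι] {xa : ι → E → ℝ} (hxa : ∀ k, ContDiff ℝ ∞ (xa k))
    (v : ι → E) {f g : E → ℂ} (hf : ContDiff ℝ ∞ f) (hg : ContDiff ℝ ∞ g) :
    fieldC xa v (fun x => f x + g x) = fun x => fieldC xa v f x + fieldC xa v g x := by
  ext x
  unfold fieldC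
  rw [← Finset.sum_add_distrib]
  refine Finset.sum_congr rfl fun k _ => ?_
  simp only [derivC]
  have e : mulC (xa k) (fun x => f x + g x) = fun y => mulC (xa k) f y + mulC (xa k) g y := by
    ext y; simp only [mulC]; ring
  rw [e, fderiv_fun_add ((contDiff_mulC (hxa k) hf).differentiable (by simp)).differentiableAt
    ((contDiff_mulC (hxa k) hg).differentiable (by simp)).differentiableAt]
  rfl

/-- **Leibniz for `fieldC`**: `D (ρ h) = ρ D h + (X ρ) h`. [folklore] -/
theorem fieldC_mul {ι : Type*} [Fintype ι] {xa : ι → E → ℝ} (hxa : ∀ k, ContDiff ℝ ∞ (xa k))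
    (v : ι → E) {ρ : E → ℝ} (hρ : ContDiff ℝ ∞ ρ) {h : E → ℂ} (hh : ContDiff ℝ ∞ h) :
    fieldC xa v (mulC ρ h) =
      fun x => (ρ x : ℂ) * fieldC xa v h x + (applyVF xa v ρ x : ℂ) * h x := by
  ext x
  unfold fieldC applyVF
  push_cast
  rw [Finset.mul_sum, Finset.sum_mul, ← Finset.sum_add_distrib]
  refine Finset.sum_congr rfl fun k _ => ?_
  simp only [derivC]
  have hρC : ContDiff ℝ ∞ (fun x => (ρ x : ℂ)) := Complex.ofRealCLM.contDiff.comp hρ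
  have hak : ContDiff ℝ ∞ (mulC (xa k) h) := contDiff_mulC (hxa k) hh
  have e : mulC (xa k) (mulC ρ h) = fun y => (ρ y : ℂ) * mulC (xa k) h y := by
    ext y; simp only [mulC]; ring
  rw [e, fderiv_fun_mul (hρC.differentiable (by simp)).differentiableAt
    (hak.differentiable (by simp)).differentiableAt]
  simp only [add_apply, FunLike.coe_smul, Pi.smul_apply, smul_eq_mul, mulC]
  have hd : fderiv ℝ (fun x => (ρ x : ℂ)) x (v k) = ((fderiv ℝ ρ x (v k) : ℝ) : ℂ) := by
    have := ((hρ.differentiable (by simp)).differentiableAt (x := x)).hasFDerivAt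
    have h2 : HasFDerivAt (fun x => (ρ x : ℂ)) (Complex.ofRealCLM.comp (fderiv ℝ ρ x)) x :=
      Complex.ofRealCLM.hasFDerivAt.comp x this
    rw [h2.fderiv]
    simp
  rw [hd]
  ring

/-! ### The commutator of `PfC` with a cutoff -/

namespace FlatHData.XLink

variable {V : Type*} [NormedAddCommGroup V] [InnerProductSpace ℝ V] [FiniteDimensional ℝ V]
  [MeasurableSpace V] [BorelSpace V]
variable {J : ℕ} {fd : FlatHData V J} {T : E ≃L[ℝ] V} (xl : fd.XLink T)

/-- `X^j ρ`. [folklore] -/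
def Xap (j : Fin J) (ρ : E → ℝ) : E → ℝ := applyVF (xl.xX j).xa (frameDir T FlatHData.bas) ρ

/-- `X⁰ ρ`. [folklore] -/
def X0ap (ρ : E → ℝ) : E → ℝ := applyVF xl.xX0.xa (frameDir T FlatHData.bas) ρ

/-- The zeroth-order commutator coefficient `m = ∑_j X^j (X^j ρ) - X⁰ ρ`. [folklore] -/
def mcoef (ρ : E → ℝ) : E → ℝ := fun x => (∑ j, xl.Xap j (xl.Xap j ρ) x) - xl.X0ap ρ x

/-- Smoothness of `X^j ρ`. [folklore] -/
theorem contDiff_Xap (j : Fin J) {ρ : E → ℝ} (hρ : ContDiff ℝ ∞ ρ) : ContDiff ℝ ∞ (xl.Xap j ρ) :=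
  contDiff_applyVF (xl.xX j).contDiff_xa _ hρ

/-- Smoothness of `X⁰ ρ`. [folklore] -/
theorem contDiff_X0ap {ρ : E → ℝ} (hρ : ContDiff ℝ ∞ ρ) : ContDiff ℝ ∞ (xl.X0ap ρ) :=
  contDiff_applyVF xl.xX0.contDiff_xa _ hρ

/-- Smoothness of `m`. [folklore] -/
theorem contDiff_mcoef {ρ : E → ℝ} (hρ : ContDiff ℝ ∞ ρ) : ContDiff ℝ ∞ (xl.mcoef ρ) :=
  (ContDiff.sum fun j _ => xl.contDiff_Xap j (xl.contDiff_Xap j hρ)).sub (xl.contDiff_X0ap hρ)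

/-- Compact support of `X^j ρ`. [folklore] -/
theorem hasCompactSupport_Xap (j : Fin J) {ρ : E → ℝ} (hρ : HasCompactSupport ρ) :
    HasCompactSupport (xl.Xap j ρ) := hasCompactSupport_applyVF _ _ hρ

/-- Compact support of `m`. [folklore] -/
theorem hasCompactSupport_mcoef {ρ : E → ℝ} (hρ : HasCompactSupport ρ) : HasCompactSupport (xl.mcoef ρ) := by
  have h1 : HasCompactSupport (fun x => ∑ j, xl.Xap j (xl.Xap j ρ) x) := by
    have := HasCompactSupport.finset_sum (s := Finset.univ)
      (f := fun j => xl.Xap j (xl.Xap j ρ)) fun j _ => xl.hasCompactSupport_Xap j (xl.hasCompactSupport_Xap j hρ)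
    rwa [Finset.sum_fn] at this
  exact h1.sub (hasCompactSupport_applyVF _ _ hρ)

/-- `D_j` is additive on smooth functions. [folklore] -/
theorem D_add (j : Fin J) {f g : E → ℂ} (hf : ContDiff ℝ ∞ f) (hg : ContDiff ℝ ∞ g) :
    xl.D j (fun x => f x + g x) = fun x => xl.D j f x + xl.D j g x :=
  fieldC_add (xl.xX j).contDiff_xa _ hf hg

/-- **`PfC (ρ h) = ρ PfC h + ∑_j (2 (X^jρ) D_j h + (X^j X^j ρ) h) + (X⁰ρ) h`.** [folklore] -/
theorem PfC_mul {ρ : E → ℝ} (hρ : ContDiff ℝ ∞ ρ) {h : E → ℂ} (hh : ContDiff ℝ ∞ h) :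
    xl.PfC (mulC ρ h) = fun x =>
      (ρ x : ℂ) * xl.PfC h x +
        (∑ j, (2 * (xl.Xap j ρ x : ℂ) * xl.D j h x + (xl.Xap j (xl.Xap j ρ) x : ℂ) * h x)) +
        (xl.X0ap ρ x : ℂ) * h x := by
  -- first order
  have hD : ∀ j, xl.D j (mulC ρ h) = fun x => (ρ x : ℂ) * xl.D j h x + (xl.Xap j ρ x : ℂ) * h x :=
    fun j => fieldC_mul (xl.xX j).contDiff_xa _ hρ hh
  have hD0 : xl.D0 (mulC ρ h) = fun x => (ρ x : ℂ) * xl.D0 h x + (xl.X0ap ρ x : ℂ) * h x :=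
    fieldC_mul xl.xX0.contDiff_xa _ hρ hh
  -- second order
  have hDD : ∀ j, xl.D j (xl.D j (mulC ρ h)) = fun x =>
      (ρ x : ℂ) * xl.D j (xl.D j h) x + 2 * (xl.Xap j ρ x : ℂ) * xl.D j h x +
        (xl.Xap j (xl.Xap j ρ) x : ℂ) * h x := by
    intro j
    rw [hD j]
    have hDh : ContDiff ℝ ∞ (xl.D j h) := xl.contDiff_D j hh
    have hη : ContDiff ℝ ∞ (xl.Xap j ρ) := xl.contDiff_Xap j hρ
    have h1 : ContDiff ℝ ∞ (mulC ρ (xl.D j h)) := contDiff_mulC hρ hDh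
    have h2 : ContDiff ℝ ∞ (mulC (xl.Xap j ρ) h) := contDiff_mulC hη hh
    have e : (fun x => (ρ x : ℂ) * xl.D j h x + (xl.Xap j ρ x : ℂ) * h x) =
        fun x => mulC ρ (xl.D j h) x + mulC (xl.Xap j ρ) h x := by
      ext x; simp only [mulC]
    rw [e, xl.D_add j h1 h2]
    change (fun x => fieldC (xl.xX j).xa (frameDir T FlatHData.bas) (mulC ρ (xl.D j h)) x +
      fieldC (xl.xX j).xa (frameDir T FlatHData.bas) (mulC (xl.Xap j ρ) h) x) = _
    rw [fieldC_mul (xl.xX j).contDiff_xa _ hρ hDh, fieldC_mul (xl.xX j).contDiff_xa _ hη hh]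
    ext x
    simp only [FlatHData.XLink.Xap, FlatHData.XLink.D]
    ring
  -- zeroth order
  have hc : ∀ x, (xl.cfull x : ℂ) * mulC ρ h x = (ρ x : ℂ) * ((xl.cfull x : ℂ) * h x) := fun x => by
    simp only [mulC]; ring
  -- assemble
  ext x
  simp only [FlatHData.XLink.PfC]
  rw [Finset.sum_congr rfl fun j _ => congrFun (hDD j) x, hD0, hc x]
  simp only [Finset.sum_add_distrib, ← Finset.mul_sum]
  ring

/-- **The commutator identity**: `ρ PfC h = PfC (ρ h) - 2 ∑_j D_j ((X^jρ) h) + m h`. [folklore] -/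
theorem cutoff_PfC {ρ : E → ℝ} (hρ : ContDiff ℝ ∞ ρ) {h : E → ℂ} (hh : ContDiff ℝ ∞ h) :
    (fun x => (ρ x : ℂ) * xl.PfC h x) = fun x =>
      xl.PfC (mulC ρ h) x -
        2 * (∑ j, xl.D j (mulC (xl.Xap j ρ) h) x) + (xl.mcoef ρ x : ℂ) * h x := by
  have hmain := xl.PfC_mul hρ hh
  -- `(X^jρ) D_j h = D_j ((X^jρ) h) - (X^j X^j ρ) h`
  have hK1 : ∀ j x, (xl.Xap j ρ x : ℂ) * xl.D j h x =
      xl.D j (mulC (xl.Xap j ρ) h) x - (xl.Xap j (xl.Xap j ρ) x : ℂ) * h x := by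
    intro j x
    have := congrFun (fieldC_mul (xl.xX j).contDiff_xa (frameDir T FlatHData.bas) (xl.contDiff_Xap j hρ) hh) x
    change xl.D j (mulC (xl.Xap j ρ) h) x =
      (xl.Xap j ρ x : ℂ) * xl.D j h x + (xl.Xap j (xl.Xap j ρ) x : ℂ) * h x at this
    linear_combination -this
  ext x
  have hm := congrFun hmain x
  have hs : ∑ j, (2 * (xl.Xap j ρ x : ℂ) * xl.D j h x + (xl.Xap j (xl.Xap j ρ) x : ℂ) * h x) =
      2 * (∑ j, xl.D j (mulC (xl.Xap j ρ) h) x) - (∑ j, (xl.Xap j (xl.Xap j ρ) x : ℂ)) * h x := by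
    rw [Finset.mul_sum, Finset.sum_mul, ← Finset.sum_sub_distrib]
    refine Finset.sum_congr rfl fun j _ => ?_
    linear_combination 2 * hK1 j x
  change xl.PfC (mulC ρ h) x = _ at hm
  rw [hs] at hm
  simp only [FlatHData.XLink.mcoef]
  push_cast
  linear_combination -hm

end FlatHData.XLink

/-! ### Changing the cutoff in `uC` -/

/-- If `ζ' ζ = ζ` then `uC u ζ g = uC u ζ' (ζ g)`. [folklore] -/
theorem uC_cutoff (u : 𝓓'(Ω, ℝ)) {ζ ζ' : 𝓓(Ω, ℝ)} (hζ : ∀ x, ζ' x * ζ x = ζ x) {g : E → ℂ}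
    (hg : ContDiff ℝ ∞ g) : uC u ζ g = uC u ζ' (mulC ζ g) := by
  have hζg : ContDiff ℝ ∞ (mulC ζ g) := contDiff_mulC ζ.contDiff hg
  rw [uC_eq u ζ hg, uC_eq u ζ' hζg]
  have e1 : mulSmooth ζ (fun x => (g x).re) (Complex.reCLM.contDiff.comp hg) =
      mulSmooth ζ' (fun x => (mulC ζ g x).re) (Complex.reCLM.contDiff.comp hζg) := by
    ext x; simp [mulC, Complex.mul_re, ← mul_assoc, hζ x]
  have e2 : mulSmooth ζ (fun x => (g x).im) (Complex.imCLM.contDiff.comp hg) =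
      mulSmooth ζ' (fun x => (mulC ζ g x).im) (Complex.imCLM.contDiff.comp hζg) := by
    ext x; simp [mulC, Complex.mul_im, ← mul_assoc, hζ x]
  rw [e1, e2]

/-! ### The Fourier side of a smooth density -/

variable {V : Type*} [NormedAddCommGroup V] [InnerProductSpace ℝ V] [FiniteDimensional ℝ V]
  [MeasurableSpace V] [BorelSpace V]

/-- Conjugation preserves the weighted norms. [folklore] -/
theorem wnorm_conj (t : ℝ) (F : V → ℂ) : wnorm t (fun ξ => conj (F ξ)) = wnorm t F :=
  le_antisymm (wnorm_le_of_enorm_le fun ξ => by simp) (wnorm_le_of_enorm_le fun ξ => by simp)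

/-- A constant multiple of the inverse Fourier transform of a Schwartz function is `Nice`.
[folklore] -/
theorem nice_const_mul_fourierInv (c : ℂ) (q : 𝓢(V, ℂ)) : Nice (fun ξ => c * 𝓕⁻ (q : V → ℂ) ξ) := by
  have h := SchwartzMap.nice (𝓕⁻ q)
  rw [SchwartzMap.fourierInv_coe] at h
  exact h.const_mul c

variable [MeasurableSpace E] (μ : Measure E)

/-- **The Fourier side of a smooth density** `F ζ dμ` whose Schwartz avatar is `q`
(`F ζ = q ∘ T`): with the change of variables `∫ g ∘ T dμ = c_T ∫ g`,
`∫ F ζ conj(𝓕ψ ∘ T) dμ = pairing (c_T 𝓕⁻¹ q) ψ`. [folklore] -/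
theorem integral_density_eq_pairing {T : E →L[ℝ] V} {cT : ℂ}
    (hT : ∀ g : V → ℂ, ∫ x, g (T x) ∂μ = cT * ∫ y, g y) {Fζ : E → ℂ} {q : 𝓢(V, ℂ)}
    (hq : ∀ x, Fζ x = q (T x)) (ψ : 𝓢(V, ℂ)) :
    ∫ x, Fζ x * conj (𝓕 ψ (T x)) ∂μ = pairing (fun ξ => cT * 𝓕⁻ (q : V → ℂ) ξ) ψ := by
  have e1 : (fun x => Fζ x * conj (𝓕 ψ (T x))) = fun x => (fun y => q y * conj (𝓕 ψ y)) (T x) := by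
    ext x; rw [hq x]
  rw [e1, hT (fun y => q y * conj (𝓕 ψ y))]
  -- multiplication formula in sesquilinear form: `∫ conj (𝓕ψ) q = ∫ conj ψ (𝓕⁻ q)`
  have hs := SchwartzMap.integral_sesq_fourier_eq ψ q (innerSL ℂ (E := ℂ))
  simp only [innerSL_apply_apply, RCLike.inner_apply'] at hs
  have e2 : ∫ y, q y * conj (𝓕 ψ y) = ∫ y, conj (ψ y) * 𝓕⁻ (q : V → ℂ) y := by
    have e3 : (fun y => q y * conj (𝓕 ψ y)) = fun y => conj (𝓕 ψ y) * q y := by ext y; ring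
    rw [e3]
    rw [SchwartzMap.fourierInv_coe] at hs
    convert hs using 1
  rw [e2, pairing_const_mul_left]
  unfold pairing
  congr 1
  refine integral_congr_ae (Eventually.of_forall fun y => ?_)
  ring

/-! ### The key identity -/

namespace FlatHData.XLink

variable {J : ℕ} {fd : FlatHData V J} {T : E ≃L[ℝ] V} (xl : fd.XLink T)
variable {u : 𝓓'(Ω, ℝ)} {ζ ζ' : 𝓓(Ω, ℝ)}

/-- **The tested form of the key identity**: for `G` representing `id` w.r.t. `ζ`, `G'` w.r.t. `ζ'`
(`ζ' = 1` on `tsupport ζ`, encoded as `ζ' ζ = ζ`, `ζ' (X^jζ) = X^jζ`, `ζ' m = m`), Schwartz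
avatars `bη j` of `X^j ζ` and `bm` of `m`, the hypothesis `uC u ζ' (PfC (ζ g)) = ∫ Fζ g dμ`
and the change of variables: the pairings of `Pf G` are those of
`c_T 𝓕⁻¹ q - 2 ∑_j conv_{η_j} (Xf_j G') + conv_m G'`. [folklore] -/
theorem pairing_Pf_eq {G G' : V → ℂ} (hG : Rep u ζ (T : E →L[ℝ] V) G id)
    (hG' : Rep u ζ' (T : E →L[ℝ] V) G' id)
    (hζ : ∀ x, ζ' x * ζ x = ζ x)
    (bη : Fin J → 𝓢(V, ℂ)) (hbη : ∀ j x, (xl.Xap j ζ x : ℂ) = bη j (T x))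
    (bm : 𝓢(V, ℂ)) (hbm : ∀ x, (xl.mcoef ζ x : ℂ) = bm (T x))
    {μ : Measure E} {Fζ : E → ℂ}
    (hPu : ∀ g : E → ℂ, ContDiff ℝ ∞ g → uC u ζ' (xl.PfC (mulC ζ g)) = ∫ x, Fζ x * g x ∂μ)
    {q : 𝓢(V, ℂ)} (hq : ∀ x, Fζ x = q (T x)) {cT : ℂ}
    (hT : ∀ g : V → ℂ, ∫ x, g (T x) ∂μ = cT * ∫ y, g y) (ψ : 𝓢(V, ℂ)) :
    pairing (fd.Pf G) ψ =
      pairing (fun ξ => cT * 𝓕⁻ (q : V → ℂ) ξ -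
        2 * (∑ j, kerOp (convKer (thetaOf (bη j))) (fd.Xf j G') ξ) +
        kerOp (convKer (thetaOf bm)) G' ξ) ψ := by
  set h : E → ℂ := fun x => conj (𝓕 ψ ((T : E →L[ℝ] V) x)) with hh
  have hhs : ContDiff ℝ ∞ h := contDiff_conj_fourier_comp _ ψ
  -- the left side through the shadow of `Pf`
  have hP := (hG.Pf xl).eq ψ
  simp only [id] at hP
  rw [hP]
  change uC u ζ (xl.PfC h) = _
  -- change cutoff and expand the commutator
  rw [uC_cutoff u hζ (xl.contDiff_PfC hhs)]
  have ecut : mulC ζ (xl.PfC h) = fun x => (ζ x : ℂ) * xl.PfC h x := rfl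
  rw [ecut, xl.cutoff_PfC ζ.contDiff hhs]
  -- the three pieces are smooth
  have p1 : ContDiff ℝ ∞ (xl.PfC (mulC ζ h)) := xl.contDiff_PfC (contDiff_mulC ζ.contDiff hhs)
  have p2j : ∀ j, ContDiff ℝ ∞ (xl.D j (mulC (xl.Xap j ζ) h)) := fun j =>
    xl.contDiff_D j (contDiff_mulC (xl.contDiff_Xap j ζ.contDiff) hhs)
  have p2 : ContDiff ℝ ∞ (fun x => ∑ j, xl.D j (mulC (xl.Xap j ζ) h) x) := ContDiff.sum fun j _ => p2j j
  have p3 : ContDiff ℝ ∞ (fun x => (xl.mcoef ζ x : ℂ) * h x) :=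
    (Complex.ofRealCLM.contDiff.comp (xl.contDiff_mcoef ζ.contDiff)).mul hhs
  -- linearity of `uC`
  have e1 : (fun x => xl.PfC (mulC ζ h) x - 2 * (∑ j, xl.D j (mulC (xl.Xap j ζ) h) x) +
      (xl.mcoef ζ x : ℂ) * h x) = fun x => (xl.PfC (mulC ζ h) x +
        (-2) * (∑ j, xl.D j (mulC (xl.Xap j ζ) h) x)) + (xl.mcoef ζ x : ℂ) * h x := by
    ext x; ring
  rw [e1, uC_add u ζ' (p1.add (contDiff_const.mul p2)) p3, uC_add u ζ' p1 (contDiff_const.mul p2),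
    uC_const_mul u ζ' (-2) p2]
  -- `uC` of the sum over `j` is the sum of the `uC`s
  have hsumC : ∀ (S : Finset (Fin J)), uC u ζ' (fun x => ∑ j ∈ S, xl.D j (mulC (xl.Xap j ζ) h) x) =
      ∑ j ∈ S, uC u ζ' (xl.D j (mulC (xl.Xap j ζ) h)) := by
    intro S
    classical
    induction S using Finset.induction_on with
    | empty =>
      simp only [Finset.sum_empty]
      have := uC_const_mul u ζ' 0 (h := fun _ : E => (0 : ℂ)) contDiff_const
      simpa using this
    | insert a S ha ih =>
      simp only [Finset.sum_insert ha]
      rw [uC_add u ζ' (p2j a) (ContDiff.sum fun j _ => p2j j), ih]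
  rw [hsumC Finset.univ, hPu h hhs]
  -- the right side: pairings of the three Fourier-side functions
  have hψ := SchwartzMap.nice ψ
  obtain ⟨t', ht'⟩ := hG'.inH
  have iN : InH 0 (fun ξ => cT * 𝓕⁻ (q : V → ℂ) ξ) := (nice_const_mul_fourierInv cT q).inH 0
  have iXj : ∀ j, InH (t' - 1) (kerOp (convKer (thetaOf (bη j))) (fd.Xf j G')) := fun j => by
    have := (rapidDecay_thetaOf (bη j)).kerDecay_convKer.inH_kerOp ((fd.X j).inH_applyF FlatHData.bas ht')
    rwa [sub_zero] at this
  have iS : InH (t' - 1) (fun ξ => ∑ j, kerOp (convKer (thetaOf (bη j))) (fd.Xf j G') ξ) :=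
    InH.finset_sum _ iXj
  have iM : InH t' (kerOp (convKer (thetaOf bm)) G') := by
    have := (rapidDecay_thetaOf bm).kerDecay_convKer.inH_kerOp ht'; rwa [sub_zero] at this
  -- common level
  set s : ℝ := min 0 (t' - 1) with hs
  have iN' := iN.mono (min_le_left _ _ : s ≤ 0)
  have iS' := (iS.const_mul 2).mono (min_le_right _ _ : s ≤ t' - 1)
  have iM' := iM.mono (show s ≤ t' by rw [hs]; exact (min_le_right _ _).trans (by linarith))
  rw [pairing_add_left (iN'.sub iS') iM' (hψ.inH _), pairing_sub_left iN' iS' (hψ.inH _),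
    pairing_const_mul_left (2 : ℂ)]
  -- identify the three pairings
  have hT' : ∀ g : V → ℂ, ∫ x, g ((T : E →L[ℝ] V) x) ∂μ = cT * ∫ y, g y := hT
  have hq' : ∀ x, Fζ x = q ((T : E →L[ℝ] V) x) := hq
  have q1 : pairing (fun ξ => cT * 𝓕⁻ (q : V → ℂ) ξ) ψ = ∫ x, Fζ x * h x ∂μ :=
    (integral_density_eq_pairing μ hT' hq' ψ).symm
  have q2 : pairing (fun ξ => ∑ j, kerOp (convKer (thetaOf (bη j))) (fd.Xf j G') ξ) ψ =
      ∑ j, uC u ζ' (xl.D j (mulC (xl.Xap j ζ) h)) := by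
    -- each term: `conv_{η_j} (Xf_j G')` represents `D_j ∘ (η_j ·)`
    have hrep : ∀ j, Rep u ζ' (T : E →L[ℝ] V) (kerOp (convKer (thetaOf (bη j))) (fd.Xf j G'))
        (fun g => xl.D j (mulC (xl.Xap j ζ) g)) := fun j =>
      (hG'.flatField (xl.xX j)).conv (xl.contDiff_Xap j ζ.contDiff) (b := bη j) (hbη j)
    have hsum := Rep.finset_sum Finset.univ hrep
    rw [hsum.eq ψ]
    exact hsumC Finset.univ
  have q3 : pairing (kerOp (convKer (thetaOf bm)) G') ψ = uC u ζ' (fun x => (xl.mcoef ζ x : ℂ) * h x) := by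
    have hrep : Rep u ζ' (T : E →L[ℝ] V) (kerOp (convKer (thetaOf bm)) G') (fun g => mulC (xl.mcoef ζ) g) :=
      hG'.conv (xl.contDiff_mcoef ζ.contDiff) (b := bm) hbm
    exact hrep.eq ψ
  rw [q1, q2, q3]
  ring

/-- **The key identity, a.e. form.** [folklore] -/
theorem Pf_ae_eq {G G' : V → ℂ} (hG : Rep u ζ (T : E →L[ℝ] V) G id)
    (hG' : Rep u ζ' (T : E →L[ℝ] V) G' id) (hζ : ∀ x, ζ' x * ζ x = ζ x)
    (bη : Fin J → 𝓢(V, ℂ)) (hbη : ∀ j x, (xl.Xap j ζ x : ℂ) = bη j (T x))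
    (bm : 𝓢(V, ℂ)) (hbm : ∀ x, (xl.mcoef ζ x : ℂ) = bm (T x))
    {μ : Measure E} {Fζ : E → ℂ}
    (hPu : ∀ g : E → ℂ, ContDiff ℝ ∞ g → uC u ζ' (xl.PfC (mulC ζ g)) = ∫ x, Fζ x * g x ∂μ)
    {q : 𝓢(V, ℂ)} (hq : ∀ x, Fζ x = q (T x)) {cT : ℂ}
    (hT : ∀ g : V → ℂ, ∫ x, g (T x) ∂μ = cT * ∫ y, g y) :
    fd.Pf G =ᵐ[volume] fun ξ => cT * 𝓕⁻ (q : V → ℂ) ξ -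
        2 * (∑ j, kerOp (convKer (thetaOf (bη j))) (fd.Xf j G') ξ) +
        kerOp (convKer (thetaOf bm)) G' ξ := by
  obtain ⟨t, ht⟩ := (hG.Pf xl).inH
  obtain ⟨t', ht'⟩ := hG'.inH
  have iN : InH 0 (fun ξ => cT * 𝓕⁻ (q : V → ℂ) ξ) := (nice_const_mul_fourierInv cT q).inH 0
  have iXj : ∀ j, InH (t' - 1) (kerOp (convKer (thetaOf (bη j))) (fd.Xf j G')) := fun j => by
    have := (rapidDecay_thetaOf (bη j)).kerDecay_convKer.inH_kerOp ((fd.X j).inH_applyF FlatHData.bas ht')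
    rwa [sub_zero] at this
  have iS : InH (t' - 1) (fun ξ => ∑ j, kerOp (convKer (thetaOf (bη j))) (fd.Xf j G') ξ) := InH.finset_sum _ iXj
  have iM : InH t' (kerOp (convKer (thetaOf bm)) G') := by
    have := (rapidDecay_thetaOf bm).kerDecay_convKer.inH_kerOp ht'; rwa [sub_zero] at this
  set s : ℝ := min 0 (t' - 1) with hs
  have iR : InH s (fun ξ => cT * 𝓕⁻ (q : V → ℂ) ξ -
      2 * (∑ j, kerOp (convKer (thetaOf (bη j))) (fd.Xf j G') ξ) + kerOp (convKer (thetaOf bm)) G' ξ) :=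
    ((iN.mono (min_le_left _ _)).sub ((iS.const_mul 2).mono (min_le_right _ _))).add
      (iM.mono ((min_le_right _ _).trans (by linarith)))
  exact ae_eq_of_forall_pairing_schwartz ht iR fun ψ =>
    xl.pairing_Pf_eq hG hG' hζ bη hbη bm hbm hPu hq hT ψ

/-- **Corollary**: under the hypotheses of the key identity, if `G', Xf_j G' ∈ Ĥ^t` then
`Pf G ∈ Ĥ^t`. [folklore] -/
theorem inH_Pf_of_cutoff {G G' : V → ℂ} (hG : Rep u ζ (T : E →L[ℝ] V) G id)
    (hG' : Rep u ζ' (T : E →L[ℝ] V) G' id) (hζ : ∀ x, ζ' x * ζ x = ζ x)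
    (bη : Fin J → 𝓢(V, ℂ)) (hbη : ∀ j x, (xl.Xap j ζ x : ℂ) = bη j (T x))
    (bm : 𝓢(V, ℂ)) (hbm : ∀ x, (xl.mcoef ζ x : ℂ) = bm (T x))
    {μ : Measure E} {Fζ : E → ℂ}
    (hPu : ∀ g : E → ℂ, ContDiff ℝ ∞ g → uC u ζ' (xl.PfC (mulC ζ g)) = ∫ x, Fζ x * g x ∂μ)
    {q : 𝓢(V, ℂ)} (hq : ∀ x, Fζ x = q (T x)) {cT : ℂ}
    (hT : ∀ g : V → ℂ, ∫ x, g (T x) ∂μ = cT * ∫ y, g y)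
    {t : ℝ} (htG' : InH t G') (htX : ∀ j, InH t (fd.Xf j G')) : InH t (fd.Pf G) := by
  have hae := xl.Pf_ae_eq hG hG' hζ bη hbη bm hbm hPu hq hT
  have iN : InH t (fun ξ => cT * 𝓕⁻ (q : V → ℂ) ξ) := (nice_const_mul_fourierInv cT q).inH t
  have iXj : ∀ j, InH t (kerOp (convKer (thetaOf (bη j))) (fd.Xf j G')) := fun j => by
    have := (rapidDecay_thetaOf (bη j)).kerDecay_convKer.inH_kerOp (htX j); rwa [sub_zero] at this
  have iS : InH t (fun ξ => ∑ j, kerOp (convKer (thetaOf (bη j))) (fd.Xf j G') ξ) := InH.finset_sum _ iXj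
  have iM : InH t (kerOp (convKer (thetaOf bm)) G') := by
    have := (rapidDecay_thetaOf bm).kerDecay_convKer.inH_kerOp htG'; rwa [sub_zero] at this
  have iR : InH t (fun ξ => cT * 𝓕⁻ (q : V → ℂ) ξ -
      2 * (∑ j, kerOp (convKer (thetaOf (bη j))) (fd.Xf j G') ξ) + kerOp (convKer (thetaOf bm)) G' ξ) :=
    (iN.sub (iS.const_mul 2)).add iM
  obtain ⟨s, hs⟩ := (hG.Pf xl).inH
  exact ⟨hs.1, by rw [wnorm_congr_ae hae]; exact iR.2⟩

end FlatHData.XLink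

end Literature.Analysis.Hypoelliptic
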